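import Literature.MathematicalPhysics.QuantumFieldTheory.Balaban1983to89.B6Prop22TwoLevelCensus

/-!
# `Balaban1983to89.B6Prop22TwoLevelCensusUpTo` — [B6] Proposition 2.2 (2.67) in its census typing `B6.Prop22Printed` ON THE
# GENUINE TWO-LEVEL FAMILY `TLIdx`, UP TO THE ENDPOINT: for every `β < 1` the verbatim census sentence — `∃ M₁ δ₀ C C_α ∀ i …`
# (four sup entries) ∧ (two `ζ`-dressed Hölder entries) — with the Hölder exponent ranging over `0 ≤ α ≤ β` instead of
# `0 ≤ α < 1`; the mechanism is INTERPOLATION DOWN of the kernel-level Hölder bound (one exponent `β` controls every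
# `α ≤ β` with the SAME threshold and rate); plus the reduction edge «α-uniform Hölder package ⟹ the census Prop»

statement-level skeleton of published theorems with citation tags; proofs where landed; nothing here is a claim about the Yang–Mills mass gap

T. Bałaban, *Propagators and renormalization transformations for lattice gauge theories. II*, Commun. Math. Phys. **96**
(1984) 223–250 [Balaban1984PropagatorsII] («[B6]»); [3] = T. Bałaban, *Regularity and decay of lattice Green's functions*,
Commun. Math. Phys. **89** (1983) 571–597 [Balaban1983RegularityDecay].  PDF held: `paper:balaban1984-cmp96-propagators-rt-ii`
(journal page = PDF page + 222); p. 234 [PDF 12] (Prop. 2.2, (2.67)), p. 231 [PDF 9] ((2.45)–(2.46)), p. 232 [PDF 10]; [3]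
p. 573 [PDF 3] (Theorem, (1.9)).

CITATION HEADER (lean-in-tree rule).  Cell `lit-balaban` (HOME `run/shared/lean/pub/lit-balaban/`), unit `lit-balaban-r03`
gen 13 (B6 fold owner, own lane), SKELETON row **B6.Prop2.2** (cells; the head is `proved` by the one-scale model instances
`…B6Prop22BoxFamily.prop22Printed_boxFamily` / `…B6Prop22OneScaleTorus`; decls of record untouched).  A NEW LEAF on top of
this seat's gen-12 file `…B6Prop22TwoLevelCensus` (the index family `TLIdx d ℓ` of ALL two-level nested geometries
(2.1)–(2.2) on a Neumann box, its census geometry `TLIdx.geo` with the REALISED distance (2.46), the (2.67) functionals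
`TLIdx.gp` of the GENUINE two-level operator `G′ = (Δ^{ξ,N}_X + Q′*aQ′)⁻¹` of the p21 lineage, the conversions
`abs_sum_mul_le2`, `quot_eq_abs_weight`, the product rule `holder_pair_bound`, and the two census-form theorems
`prop22_supEntries_twoLevel` (= THE FIRST CONJUNCT of `B6.Prop22Printed`, `∃ M₁ δ₀ C ∀ i`) and
`prop22_holderEntries_twoLevel` (the Hölder conjunct AT EACH `α`: `∀ α ∃ M₁ δ₀ C ∀ i`)), which imports p21's
`…B6Prop22AllTwoLevelBox.prop22_six_twoLevelBox` (all six entries of (2.67) in kernel form at a given `α`) and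
`…B6Geom246MultiLevelBox` (`coord_bounds`: the coordinates of a site of the block `B^j(y)`).  Everything is consumed BY
NAME; nothing existing is modified; no definition, no `def … : Prop` fact; THEOREMS ONLY.

WHAT IS PRINTED.  p. 234: «**Proposition 2.2.** If we have (2.1), (2.2) and M is sufficiently large, then the operator
G′ = Δ′_a^{−1} (a = 1) satisfies the inequalities |(G′λ)(x)|, |(∇G′λ)(x)|, |(G′∇*λ)(x)|, ‖ζ∇G′λ‖_α, ‖ζG′∇*λ‖_α, |(ΔG′λ)(x)|
≤ O(1)[(L^jη)², L^jη, L^jη, (L^jη)^{1−α}(‖ζ‖_α + |ζ|), (L^jη)^{1−α}(‖ζ‖_α + |ζ|), 1]e^{−½δ₀d(y,y′)}|λ|, x ∈ B^j(y) or supp ζ ⊂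
B^j(y), y ∈ Λ_j, supp λ ⊂ B^{j′}(y′), y′ ∈ Λ_{j′}. (2.67)».  The census module `…B6` types it as `B6.Prop22Printed geo Gp :=
∃ M₁ δ₀ C, ∃ Cα : ℝ → ℝ, … ∀ i, Hyp21_22 → M₁ ≤ M → (sup entries with C) ∧ (∀ α, 0 ≤ α → α < 1 → Hölder entries with Cα α)` —
ONE threshold `M₁` and ONE rate `δ₀` for all `α`, an `α`-dependent `O(1)` (its docstring: «0 ≤ α < 1 with an α-dependent
O(1), as in B5 Prop. 1.2»; [3] p. 573 prints the same order for the input (1.9): «there exist positive constants δ₀, c₀,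
R₀ independent of A, k, Ω and depending on d, M only, c₀ on α also»).

THE POINT OF THIS FILE.  The tree's kernel-level Hölder chain behind the two-level entries 4, 5 — [3] Lemma 2.4 (2.36)
`…B4StripSumsHolder.hkernel248_decay` → `…B4Green242Bridge.K_holder_decay` / `greenBoxQ_holder_decay_236` →
`…B4Thm19ZeroBoxHolder.Gfine_rowwH_bound` → p21's `…B6Ineq243HolderTwoLevelBox` → `…B6Prop22HolderTwoLevelBox` →
`prop22_six_twoLevelBox` — is stated in the order `∀ α ∃ (rate, constants)`, so gen 12 could type the Hölder conjunct only
AT EACH `α` (`prop22_holderEntries_twoLevel`).  Observation (ours, one line of real analysis, not in print): on the member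
`i` two sites `x ≠ x′` of the SAME block `B^j(y)` satisfy `ξ ≤ |x′ − x| ≤ L^jη` (lattice units `ξ = L^{−k}`: `|x′−x|_∞/L^k ≤
L^{j−k} = L^jη`, from `coord_bounds`), hence for `α ≤ β`
`|F(x′) − F(x)|/|x′ − x|^α = |F(x′) − F(x)|/|x′ − x|^β · |x′ − x|^{β−α} ≤ (L^jη)^{β−α} · |F(x′) − F(x)|/|x′ − x|^β`
and `(L^jη)^{β−α} ≤ (L^jη)^{1−α}` (`L^jη ≥ 1` on the member).  So p21's bare two-centre Hölder bound AT ONE EXPONENT `β`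
(threshold `M₀(β)`, rate `δ_A(β)`, constant `C_A(β)`) bounds the pair quotient of `F = ∇^ξ_μG′λ`, `G′∇^{ξ*}_μλ` inside
`B^j(y)` AT EVERY `α ≤ β` by `(L^jη)^{β−α}·B`, `B = C_Ae^{δ_A}e^{−(δ_A/(d+1))d(y,y′)}|λ|`, and the product rule
`holder_pair_bound` dresses it with `ζ` at exponent `α`: `‖ζF‖_α ≤ ‖ζ‖_α·B + |ζ|·(L^jη)^{β−α}B ≤ (L^jη)^{1−α}(‖ζ‖_α + |ζ|)·B`.
CONSEQUENCE: the threshold and the rate of the Hölder conjunct are UNIFORM ON EVERY COMPACT EXPONENT RANGE `[0, β]`,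
`β < 1`; what separates the two-level family from the verbatim census Prop is ONLY the uniformity of `δ₀` as `α → 1`
(the `_unif` re-threading of the chain above in print's order «δ₀ depending on d, M only, c₀ on α also» — not done here).

WHAT THIS FILE PROVES (kernel-checked; 0 sorry; standard axioms):
* §1 `sep_div_le_len` — two sites of one block `B^j(y)` of the member: `|x′ − x|_∞/L^k ≤ L^jη` (`= i.geo.len y`).
* §2 (private, elementary) `quot_le_of_exponent_le` — `a/t^α ≤ ℓ^{β−α}·(a/t^β)` for `0 < t ≤ ℓ`, `α ≤ β`, `a ≥ 0`;
  `rpow_sub_le_rpow_one_sub` — `ℓ^{β−α} ≤ ℓ^{1−α}` for `ℓ ≥ 1`, `β ≤ 1`.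
* §3 **`prop22_holderEntries_twoLevel_upTo`** — for every `0 ≤ β < 1` there are `M₁, δ₀, C > 0` (those of gen 12 at `β`)
  such that FOR EVERY `0 ≤ α ≤ β`, every member with `M ≥ M₁`, every `λ` with `supp λ ⊂ B(y′)`, every `ζ` with
  `supp ζ ⊂ B(y)`: `max_μ max(‖ζ∇^ξ_μG′λ‖_α, ‖ζG′∇^{ξ*}_μλ‖_α) ≤ C·(L^jη)^{1−α}·(‖ζ‖_α + |ζ|)·e^{−½δ₀d(y,y′)}·|λ|` — the
  Hölder conjunct of `B6.Prop22Printed` with quantifier order `∃ (M₁, δ₀, C) ∀ α ∈ [0, β]`.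
* §4 **`prop22Printed_twoLevel_upTo`** — for every `β < 1`: LITERALLY the body of `B6.Prop22Printed (fun i : TLIdx d ℓ =>
  i.geo) (fun i => i.gp)` with the single token `α < 1` replaced by `α ≤ β` (both conjuncts, ONE `M₁`, ONE `δ₀`, the
  printed prefactors `pref4`, `∃ Cα : ℝ → ℝ`), from §3 at `max β 0` and `prop22_supEntries_twoLevel` with `M₁ := max`,
  `δ₀ := min`.  Non-vacuity of the family at every threshold: gen 12's `twoLevel_nonvacuous` (members with blocks at BOTH
  levels, `L^jη ∈ {1, L}`, the two-level distance (2.46)).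
* §5 `prop22Printed_twoLevel_of_holderUnif` — THE REDUCTION EDGE: an `α`-UNIFORM Hölder package (`∃ M₁ δ₀ ∀ α < 1 ∃ C ∀ i …`,
  exactly the output a `_unif` re-threading of the [3]-chain would deliver) implies the VERBATIM `B6.Prop22Printed` on the
  two-level family.  A proved implication, not a claim: its hypothesis is NOT discharged here.

HONEST SCOPE.  (1) NOT the census Prop: §4 has `α ≤ β` for an arbitrary but FIXED `β < 1`, the verbatim Prop has `α < 1`
under one `δ₀`; the head of row B6.Prop2.2 does not move.  (2) Everything else is the honest scope of
`…B6Prop22TwoLevelCensus` verbatim: two levels (`k`, `k+1`) on a Neumann box with `Ω₁ = … = Ω_k = X` (print admits equal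
domains, p. 224), `A = 0`, `m² = 0`, `a = 1` (printed weights `aPrinted`), entry 3/5 per component `μ`, forward differences
along bonds of the box, realised distance (2.46) = graph distance of touching blocks (reading R2 of HOME/GAPS.md G-B6-22),
constants existential (closed terms of the lineage's constants; `C`, `Cα` depend on `d`, `L`, `β`).  (3) The interpolation
inequality of §2 is elementary real analysis (ours); the print does not discuss the quantifier order.  NOT summit progress.
-/

noncomputable section

open scoped BigOperators
open Finset Matrix

namespace Literature.MathematicalPhysics.QuantumFieldTheory.Balaban1983to89.B6Prop22TwoLevelCensusUpTo

open Literature.MathematicalPhysics.QuantumFieldTheory.Balaban1983to89.B4ContourShift (supNorm abs_le_supNorm supNorm_nonneg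
  exists_supNorm_eq)
open Literature.MathematicalPhysics.QuantumFieldTheory.Balaban1983to89.B4Reflection242 (boxDom mem_boxDom blk)
open Literature.MathematicalPhysics.QuantumFieldTheory.Balaban1983to89.B4Thm110ZeroBox (roww)
open Literature.MathematicalPhysics.QuantumFieldTheory.Balaban1983to89.B4Thm110ZeroBoxDeriv (wsum)
open Literature.MathematicalPhysics.QuantumFieldTheory.Balaban1983to89.B4Lemma22ZeroBoxDerivDual (fwd)
open Literature.MathematicalPhysics.QuantumFieldTheory.Balaban1983to89.B4Thm19ZeroBoxHolder (wsum2)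
open Literature.MathematicalPhysics.QuantumFieldTheory.Balaban1983to89.B4StripSumsHolder (one_le_supNorm)
open Literature.MathematicalPhysics.QuantumFieldTheory.Balaban1983to89.B6MultiLevelBoxOperator (N0 Domains aPrinted
  aPrinted_window)
open Literature.MathematicalPhysics.QuantumFieldTheory.Balaban1983to89.B6Geom246MultiLevelBox (bset blkOf bond coord_bounds)
open Literature.MathematicalPhysics.QuantumFieldTheory.Balaban1983to89.B6Ineq243TwoLevelBox (gTwoLevel IsBlockUnion)
open Literature.MathematicalPhysics.QuantumFieldTheory.Balaban1983to89.B6Ineq243AdjTwoLevelBox (dstar)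
open Literature.MathematicalPhysics.QuantumFieldTheory.Balaban1983to89.B6Prop22AllTwoLevelBox (prop22_six_twoLevelBox)
open Literature.MathematicalPhysics.QuantumFieldTheory.Balaban1983to89.B6Prop22TwoLevelCensus (TLIdx prop22_supEntries_twoLevel)
open Literature.MathematicalPhysics.QuantumFieldTheory.Balaban1983to89.B6 (Geometry GpFamily Prop22Printed pref4)

variable {d ℓ : ℕ}

/-! ## §1 Two sites of one block are at distance `≤ L^jη` -/

/-- **TWO SITES OF ONE BLOCK `B^j(y)` OF THE MEMBER ARE AT DISTANCE `≤ L^jη`**: `|x′ − x|_∞/L^k ≤ L^{j−k} = L^jη` (both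
coordinates lie in `[L^j·y_μ, L^j·y_μ + L^j)`, p21's `coord_bounds`). [cite: Balaban1984PropagatorsII, (2.1) p.224 +
(2.45) p.231 («x ∈ B^j(y)»), dictionary] -/
theorem sep_div_le_len (i : TLIdx d ℓ) {x x' : ↥(i.XB)} {y : ↥(bset i.dom)} (hx : i.blkD x = y) (hx' : i.blkD x' = y) :
    supNorm (x'.1 - x.1) / ((i.n : ℕ) : ℝ) ≤ i.geo.len y := by
  have hxD : blkOf i.dom (i.toD x) = y := hx
  have hxD' : blkOf i.dom (i.toD x') = y := hx'
  obtain ⟨μ, hμ⟩ := exists_supNorm_eq (x'.1 - x.1)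
  obtain ⟨h1, h2⟩ := coord_bounds i.dom hxD μ
  obtain ⟨h1', h2'⟩ := coord_bounds i.dom hxD' μ
  rw [TLIdx.toD_val] at h1 h2 h1' h2'
  have hn : (0 : ℝ) < ((i.n : ℕ) : ℝ) := by exact_mod_cast lt_of_lt_of_le Nat.one_pos i.one_le_n
  -- `|x′_μ − x_μ| ≤ L^j` in `ℤ`, hence in `ℝ`
  have hint : |(x'.1 - x.1) μ| ≤ (((ℓ + 1) ^ y.1.1 : ℕ) : ℤ) := by
    rw [Pi.sub_apply, abs_le]
    constructor <;> linarith
  have hreal : supNorm (x'.1 - x.1) ≤ ((ℓ : ℝ) + 1) ^ y.1.1 := by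
    rw [hμ]
    have : (((|(x'.1 - x.1) μ| : ℤ)) : ℝ) ≤ ((((ℓ + 1) ^ y.1.1 : ℕ) : ℤ) : ℝ) := by exact_mod_cast hint
    refine this.trans (le_of_eq ?_)
    push_cast; ring
  rw [TLIdx.geo_len, div_eq_mul_inv]
  exact mul_le_mul_of_nonneg_right hreal (inv_nonneg.2 hn.le)

/-! ## §2 Interpolation down in the Hölder exponent (elementary) -/

/-- **INTERPOLATION DOWN**: `a/t^α ≤ ℓ^{β−α}·(a/t^β)` for `0 < t ≤ ℓ`, `α ≤ β`, `a ≥ 0` (`a/t^α = (a/t^β)·t^{β−α}` and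
`t^{β−α} ≤ ℓ^{β−α}`). [folklore] -/
private theorem quot_le_of_exponent_le {t a ln α β : ℝ} (ht : 0 < t) (htl : t ≤ ln) (hαβ : α ≤ β) (ha : 0 ≤ a) :
    a / t ^ α ≤ ln ^ (β - α) * (a / t ^ β) := by
  have hsplit : t ^ β = t ^ α * t ^ (β - α) := by
    rw [← Real.rpow_add ht]; congr 1; ring
  have hα : 0 < t ^ α := Real.rpow_pos_of_pos ht α
  have hβα : 0 < t ^ (β - α) := Real.rpow_pos_of_pos ht (β - α)
  have key : a / t ^ α = t ^ (β - α) * (a / t ^ β) := by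
    rw [hsplit]; field_simp
  rw [key]
  exact mul_le_mul_of_nonneg_right (Real.rpow_le_rpow ht.le htl (sub_nonneg.2 hαβ))
    (div_nonneg ha (Real.rpow_nonneg ht.le β))

/-- `ℓ^{β−α} ≤ ℓ^{1−α}` for `ℓ ≥ 1`, `β ≤ 1`. [folklore] -/
private theorem rpow_sub_le_rpow_one_sub {ln α β : ℝ} (h1 : 1 ≤ ln) (hβ : β ≤ 1) : ln ^ (β - α) ≤ ln ^ (1 - α) :=
  Real.rpow_le_rpow_of_exponent_le h1 (by linarith)

/-- a weighted difference of two sums against `λ` is one sum. [folklore] -/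
private theorem mul_sub_sum (i : TLIdx d ℓ) (c : ℝ) (a b f : ↥(i.XB) → ℝ) :
    c * (∑ z, a z * f z - ∑ z, b z * f z) = ∑ z, (c * (a z - b z)) * f z := by
  rw [← Finset.sum_sub_distrib, Finset.mul_sum]
  exact Finset.sum_congr rfl fun z _ => by ring

/-- matrix rows: `(Tλ)(x) = Σ_z T(x,z)λ(z)`. [folklore] -/
private theorem mulVec_eq_sum (i : TLIdx d ℓ) (T : Matrix ↥(i.XB) ↥(i.XB) ℝ) (f : ↥(i.XB) → ℝ) (x : ↥(i.XB)) :
    (T *ᵥ f) x = ∑ z, T x z * f z := rfl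

/-- the weighted row functional `roww` of the lineage is the `wsum` of the row. [folklore] -/
private theorem roww_eq_wsum (i : TLIdx d ℓ) (δ : ℝ) (T : Matrix ↥(i.XB) ↥(i.XB) ℝ) (x : ↥(i.XB)) :
    roww δ i.n T x = wsum δ i.n x (fun z => T x z) := rfl

/-- difference of two rows applied to `λ`. [folklore] -/
private theorem mulVec_sub_eq_sum (i : TLIdx d ℓ) (T : Matrix ↥(i.XB) ↥(i.XB) ℝ) (f : ↥(i.XB) → ℝ) (a b : ↥(i.XB))
    (c : ℝ) : c * ((T *ᵥ f) a - (T *ᵥ f) b) = ∑ z, (c * (T a z - T b z)) * f z := by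
  simp only [mulVec_eq_sum, ← Finset.sum_sub_distrib, Finset.mul_sum]
  refine Finset.sum_congr rfl fun z _ => ?_
  ring

/-! ## §3 The Hölder entries (2.67)₄,₅ in census form with `(M₁, δ₀, C)` UNIFORM over `α ∈ [0, β]` -/

/-- **PROPOSITION 2.2 (2.67), THE HÖLDER ENTRIES 4 AND 5 ON THE GENUINE TWO-LEVEL FAMILY, WITH ONE THRESHOLD, ONE RATE AND
ONE CONSTANT FOR ALL EXPONENTS `0 ≤ α ≤ β`** (`β < 1` fixed): there are `M₁, δ₀, C > 0` (depending on `d`, `L`, `β`) such that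
for EVERY `0 ≤ α ≤ β`, every member with `M ≥ M₁`, every `λ` with `supp λ ⊂ B(y′)` and every cut-off `ζ` with `supp ζ ⊂ B(y)`:
`max_μ max(‖ζ∇^ξ_μG′λ‖_α, ‖ζG′∇^{ξ*}_μλ‖_α) ≤ C·(L^jη)^{1−α}·(‖ζ‖_α + |ζ|)·e^{−½δ₀d(y,y′)}·|λ|`.  From p21's kernel-form
package `prop22_six_twoLevelBox` AT THE SINGLE EXPONENT `β` (its entries 2, 3 for the sup of `F`, its entries 4, 5 for the
pair quotient of `F` at `β`), the interpolation `quot_le_of_exponent_le` with `|x′ − x| ≤ L^jη` (`sep_div_le_len`), and the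
product rule `holder_pair_bound` at `α`.  (Quantifier order `∀ β ∃ (M₁, δ₀, C) ∀ α ≤ β`; gen 12's
`prop22_holderEntries_twoLevel` is the case `α = β`.) [cite: Balaban1984PropagatorsII, Prop. 2.2 (2.67) p.234 (entries 4, 5);
(2.46) p.231; p.232; Balaban1983RegularityDecay, Thm (1.9) p.573] -/
theorem prop22_holderEntries_twoLevel_upTo (d ℓ : ℕ) (hℓ : 1 ≤ ℓ) (β : ℝ) (hβ0 : 0 ≤ β) (hβ1 : β < 1) :
    ∃ M₁ δ₀ C : ℝ, 0 < M₁ ∧ 0 < δ₀ ∧ 0 < C ∧ ∀ α : ℝ, 0 ≤ α → α ≤ β →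
      ∀ i : TLIdx d ℓ, i.geo.Hyp21_22 → M₁ ≤ i.geo.M →
        ∀ (lam : i.geo.Loc) (ζ : i.geo.Cut) (y y' : i.geo.Site), i.geo.cutIn ζ y → i.geo.suppIn lam y' →
          i.gp.h1 lam α ζ ≤ C * (i.geo.len y) ^ (1 - α) * i.geo.cutH α ζ *
            Real.exp (-(δ₀ / 2 * i.geo.dist y y')) * i.geo.supNorm lam := by
  classical
  set amin : ℝ := 1 - ((((ℓ : ℝ) + 1)) ^ 2)⁻¹ with hamin_def
  have hL2 : (1 : ℝ) < (((ℓ : ℝ) + 1)) ^ 2 := by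
    have : (2 : ℝ) ≤ (ℓ : ℝ) + 1 := by
      have : (1 : ℝ) ≤ ℓ := by exact_mod_cast hℓ
      linarith
    nlinarith
  have hamin : 0 < amin := by
    rw [hamin_def, sub_pos]
    exact inv_lt_one_of_one_lt₀ hL2
  -- p21's kernel-form package AT THE EXPONENT β
  obtain ⟨δA, M0, CA, hδA, hM0, hCA, hAll⟩ :=
    prop22_six_twoLevelBox d ℓ hℓ amin 1 0 1 1 hamin one_pos β hβ0 hβ1
  refine ⟨max M0 (3 * ((ℓ : ℝ) + 1)), 2 * (δA / (d + 1)), CA * Real.exp δA, lt_max_of_lt_left hM0, by positivity,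
    by positivity, ?_⟩
  intro α hα0 hαβ i _ hM lam ζ y y' hcut hsupp
  change ↥(i.XB) → ℝ at lam
  change ↥(i.XB) → ℝ at ζ
  rw [TLIdx.geo_M] at hM
  have hM0' : M0 ≤ ((ℓ : ℝ) + 1) * i.Mh := le_trans (le_max_left _ _) hM
  have hMh3 : 3 ≤ i.Mh := by
    have h3 : 3 * ((ℓ : ℝ) + 1) ≤ ((ℓ : ℝ) + 1) * i.Mh := le_trans (le_max_right _ _) hM
    have hL : (0 : ℝ) < (ℓ : ℝ) + 1 := by positivity
    have : (3 : ℝ) ≤ i.Mh := by nlinarith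
    exact_mod_cast this
  obtain ⟨haj1, haj2, _⟩ := aPrinted_window hℓ one_pos i.hk
  rw [one_mul] at haj1
  obtain ⟨-, h2, h3, h4, h5, -⟩ := hAll i.k i.hk (aPrinted ℓ 1 i.k) 0 1 haj1 haj2 le_rfl le_rfl le_rfl le_rfl i.Mh hMh3
    hM0' (fun μ => (ℓ + 1) * i.P μ)
    (fun μ => Nat.one_le_iff_ne_zero.2 (Nat.mul_ne_zero_iff.2 ⟨by omega, by have := i.hP μ; omega⟩)) i.LamU i.isBlockUnion_LamU
  -- read them on the member's operator `i.G`
  have h2' : ∀ (μ : Fin (d + 1)) (x xe : ↥(i.XB)), xe.1 = x.1 + Pi.single μ 1 →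
      wsum δA i.n x (fun z => ((i.n : ℕ) : ℝ) * (i.G xe z - i.G x z)) ≤ CA := h2
  have h3' : ∀ (μ : Fin (d + 1)) (x : ↥(i.XB)), roww δA i.n (dstar i.n μ i.G) x ≤ CA := h3
  have h4' : ∀ (μ : Fin (d + 1)) (x xe x' xe' : ↥(i.XB)), xe.1 = x.1 + Pi.single μ 1 → xe'.1 = x'.1 + Pi.single μ 1 →
      x'.1 ≠ x.1 → wsum2 δA i.n x x' (fun z => (((i.n : ℕ) : ℝ) / supNorm (x'.1 - x.1)) ^ β
        * (((i.n : ℕ) : ℝ) * ((i.G xe' z - i.G x' z) - (i.G xe z - i.G x z)))) ≤ CA := h4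
  have h5' : ∀ (μ : Fin (d + 1)) (x x' : ↥(i.XB)), x'.1 ≠ x.1 →
      wsum2 δA i.n x x' (fun z => (((i.n : ℕ) : ℝ) / supNorm (x'.1 - x.1)) ^ β
        * (dstar i.n μ i.G x' z - dstar i.n μ i.G x z)) ≤ CA := h5
  -- common shape of the target
  have hδ2 : 2 * (δA / (d + 1)) / 2 = δA / (d + 1) := by ring
  rw [hδ2, TLIdx.geo_supNorm]
  rw [TLIdx.geo_suppIn] at hsupp
  change ∀ w, ζ w ≠ 0 → i.blkD w = y at hcut
  change i.hH lam α ζ ≤ CA * Real.exp δA * (i.geo.len y) ^ (1 - α) * (i.hq α ζ + i.supF ζ) *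
    Real.exp (-(δA / (d + 1) * i.geo.dist y y')) * i.supF lam
  set E : ℝ := Real.exp (-(δA / (d + 1) * i.geo.dist y y')) with hE
  have hE0 : 0 ≤ E := (Real.exp_pos _).le
  have hS0 := i.supF_nonneg lam
  have hq0 := i.hq_nonneg α ζ
  have hz0 := i.supF_nonneg ζ
  have hlen1 : 1 ≤ i.geo.len y := i.one_le_len y
  have hpref : 1 ≤ (i.geo.len y) ^ (1 - α) := Real.one_le_rpow hlen1 (by linarith)
  -- the Hölder gain available between the exponents: `W = (L^jη)^{β−α} ≤ (L^jη)^{1−α}`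
  set W : ℝ := (i.geo.len y) ^ (β - α) with hW
  have hW0 : 0 ≤ W := Real.rpow_nonneg (by linarith) _
  have hWle : W ≤ (i.geo.len y) ^ (1 - α) := rpow_sub_le_rpow_one_sub hlen1 hβ1.le
  -- the generic value bound `B` (sup of `F` AND the `β`-Hölder quotient of `F`) and the final comparison
  set B : ℝ := CA * Real.exp δA * E * i.supF lam with hB
  have hB0 : 0 ≤ B := by positivity
  have hfin : i.hq α ζ * B + i.supF ζ * (W * B)
      ≤ CA * Real.exp δA * (i.geo.len y) ^ (1 - α) * (i.hq α ζ + i.supF ζ) * E * i.supF lam := by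
    have e : CA * Real.exp δA * (i.geo.len y) ^ (1 - α) * (i.hq α ζ + i.supF ζ) * E * i.supF lam
        = i.hq α ζ * ((i.geo.len y) ^ (1 - α) * B) + i.supF ζ * ((i.geo.len y) ^ (1 - α) * B) := by
      rw [hB]; ring
    rw [e]
    refine add_le_add ?_ ?_
    · have : i.hq α ζ * (1 * B) ≤ i.hq α ζ * ((i.geo.len y) ^ (1 - α) * B) :=
        mul_le_mul_of_nonneg_left (mul_le_mul_of_nonneg_right hpref hB0) hq0
      rwa [one_mul] at this
    · exact mul_le_mul_of_nonneg_left (mul_le_mul_of_nonneg_right hWle hB0) hz0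
  refine le_trans ?_ hfin
  -- one-centre conversion (sup of `F` on `B(y)`) and two-centre conversion (β-Hölder quotient of `F` inside `B(y)`)
  have conv1 : ∀ (g : ↥(i.XB) → ℝ) (x : ↥(i.XB)), i.blkD x = y → wsum δA i.n x g ≤ CA →
      |∑ z, g z * lam z| ≤ B := by
    intro g x hx hg
    have h := i.abs_sum_mul_le hδA.le g lam x y' hsupp
    rw [hx] at h
    refine h.trans ?_
    have : Real.exp δA * E * wsum δA i.n x g * i.supF lam ≤ Real.exp δA * E * CA * i.supF lam :=
      mul_le_mul_of_nonneg_right (mul_le_mul_of_nonneg_left hg (by positivity)) hS0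
    rw [hB]; linarith
  have conv2 : ∀ (g : ↥(i.XB) → ℝ) (x x' : ↥(i.XB)), i.blkD x = y → i.blkD x' = y → wsum2 δA i.n x x' g ≤ CA →
      |∑ z, g z * lam z| ≤ B := by
    intro g x x' hx hx' hg
    have h := i.abs_sum_mul_le2 hδA.le g lam x x' y y' hx hx' hsupp
    refine h.trans ?_
    have : Real.exp δA * E * wsum2 δA i.n x x' g * i.supF lam ≤ Real.exp δA * E * CA * i.supF lam :=
      mul_le_mul_of_nonneg_right (mul_le_mul_of_nonneg_left hg (by positivity)) hS0
    rw [hB]; linarith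
  -- interpolation down: a `β`-quotient bound `≤ B` inside `B(y)` gives the `α`-quotient bound `≤ W·B`
  have interp : ∀ (x x' : ↥(i.XB)) (v : ℝ), i.blkD x = y → i.blkD x' = y → x'.1 ≠ x.1 →
      |v| / (supNorm (x'.1 - x.1) / i.n) ^ β ≤ B → |v| / (supNorm (x'.1 - x.1) / i.n) ^ α ≤ W * B := by
    intro x x' v hx hx' hne' hv
    have hs : 0 < supNorm (x'.1 - x.1) := lt_of_lt_of_le one_pos (one_le_supNorm (sub_ne_zero.2 hne'))
    have hn : (0 : ℝ) < ((i.n : ℕ) : ℝ) := by exact_mod_cast lt_of_lt_of_le Nat.one_pos i.one_le_n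
    have ht : 0 < supNorm (x'.1 - x.1) / i.n := div_pos hs hn
    have htl : supNorm (x'.1 - x.1) / i.n ≤ i.geo.len y := sep_div_le_len i hx hx'
    refine (quot_le_of_exponent_le ht htl hαβ (abs_nonneg v)).trans ?_
    exact mul_le_mul_of_nonneg_left hv hW0
  have hbound0 : 0 ≤ i.hq α ζ * B + i.supF ζ * (W * B) := by positivity
  refine i.hH_le_of_forall lam α ζ (fun μ => ?_) (fun μ => ?_)
  · -- entry 4: `ζ·∇^ξ_μG′λ`, bond pairs
    refine i.hqB_le_of_forall μ α _ hbound0 fun x x' hne hxm hxm' => ?_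
    have hfx : (fwd i.NB μ x).1 = x.1 + Pi.single μ 1 := B4Lemma22ZeroBoxDerivDual.fwd_val_of_mem μ x hxm
    have hfx' : (fwd i.NB μ x').1 = x'.1 + Pi.single μ 1 := B4Lemma22ZeroBoxDerivDual.fwd_val_of_mem μ x' hxm'
    refine i.holder_pair_bound α ζ (fun w => ((i.n : ℕ) : ℝ) * ((i.G *ᵥ lam) (fwd i.NB μ w) - (i.G *ᵥ lam) w)) y
      hcut x x' hne hB0 (mul_nonneg hW0 hB0) ?_ ?_ ?_
    · intro hx
      show |((i.n : ℕ) : ℝ) * ((i.G *ᵥ lam) (fwd i.NB μ x) - (i.G *ᵥ lam) x)| ≤ B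
      rw [mulVec_sub_eq_sum]; exact conv1 _ x hx (h2' μ x _ hfx)
    · intro hx'
      show |((i.n : ℕ) : ℝ) * ((i.G *ᵥ lam) (fwd i.NB μ x') - (i.G *ᵥ lam) x')| ≤ B
      rw [mulVec_sub_eq_sum]; exact conv1 _ x' hx' (h2' μ x' _ hfx')
    · intro hx hx'
      have hne' : x'.1 ≠ x.1 := fun h => hne (Subtype.ext h).symm
      show |((i.n : ℕ) : ℝ) * ((i.G *ᵥ lam) (fwd i.NB μ x') - (i.G *ᵥ lam) x')
          - ((i.n : ℕ) : ℝ) * ((i.G *ᵥ lam) (fwd i.NB μ x) - (i.G *ᵥ lam) x)| / (supNorm (x'.1 - x.1) / i.n) ^ α ≤ W * B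
      refine interp x x' _ hx hx' hne' ?_
      rw [i.quot_eq_abs_weight β x x' hne', mulVec_sub_eq_sum, mulVec_sub_eq_sum, mul_sub_sum]
      refine conv2 _ x x' hx hx' ((le_of_eq ?_).trans (h4' μ x _ x' _ hfx hfx' hne'))
      exact congrArg (wsum2 δA i.n x x') (funext fun z => by ring)
  · -- entry 5: `ζ·G′∇^{ξ*}_μλ`, site pairs
    refine i.hq_le_of_forall α _ hbound0 fun x x' hne => ?_
    refine i.holder_pair_bound α ζ (fun w => (dstar i.n μ i.G *ᵥ lam) w) y hcut x x' hne hB0 (mul_nonneg hW0 hB0)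
      ?_ ?_ ?_
    · intro hx
      show |(dstar i.n μ i.G *ᵥ lam) x| ≤ B
      rw [mulVec_eq_sum]; exact conv1 _ x hx (by rw [← roww_eq_wsum]; exact h3' μ x)
    · intro hx'
      show |(dstar i.n μ i.G *ᵥ lam) x'| ≤ B
      rw [mulVec_eq_sum]; exact conv1 _ x' hx' (by rw [← roww_eq_wsum]; exact h3' μ x')
    · intro hx hx'
      have hne' : x'.1 ≠ x.1 := fun h => hne (Subtype.ext h).symm
      show |(dstar i.n μ i.G *ᵥ lam) x' - (dstar i.n μ i.G *ᵥ lam) x| / (supNorm (x'.1 - x.1) / i.n) ^ α ≤ W * B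
      refine interp x x' _ hx hx' hne' ?_
      rw [i.quot_eq_abs_weight β x x' hne', mulVec_eq_sum, mulVec_eq_sum, mul_sub_sum]
      exact conv2 _ x x' hx hx' (h5' μ x x' hne')

/-! ## §4 `B6.Prop22Printed` on the two-level family with the Hölder exponent range `[0, β]`, `β < 1` -/

/-- the decay factor is antitone in the rate (the realised distance is `≥ 0`). [cite: Balaban1984PropagatorsII, (2.46) p.231, dictionary] -/
theorem exp_rate_mono (i : TLIdx d ℓ) {δ δ' : ℝ} (h : δ' ≤ δ) (y y' : i.geo.Site) :
    Real.exp (-(δ / 2 * i.geo.dist y y')) ≤ Real.exp (-(δ' / 2 * i.geo.dist y y')) := by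
  have hd : 0 ≤ i.geo.dist y y' := by rw [TLIdx.geo_dist]; exact Nat.cast_nonneg _
  exact Real.exp_le_exp.2 (by nlinarith)

/-- **PROPOSITION 2.2 IN ITS CENSUS TYPING ON THE GENUINE TWO-LEVEL FAMILY, UP TO THE ENDPOINT** — for every `β < 1`:
LITERALLY the body of `B6.Prop22Printed (fun i : TLIdx d ℓ => i.geo) (fun i => i.gp)` with the token `α < 1` of its Hölder
clause replaced by `α ≤ β` — ONE threshold `M₁` («M sufficiently large»), ONE rate `δ₀`, one `C` for the four sup entries
`|G′λ|, |∇G′λ|, |G′∇*λ|, |ΔG′λ| ≤ C[(L^jη)², L^jη, L^jη, 1]e^{−½δ₀d(y,y′)}|λ|` and an exponent-dependent `C_α` for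
`‖ζ∇G′λ‖_α, ‖ζG′∇*λ‖_α ≤ C_α(L^jη)^{1−α}(‖ζ‖_α + |ζ|)e^{−½δ₀d(y,y′)}|λ|`, `0 ≤ α ≤ β`, on EVERY two-level nested geometry
(2.1)–(2.2) of the Neumann box with the genuine `G′` and the realised distance (2.46).  From `prop22_supEntries_twoLevel` and
§3 (at `max β 0`) with `M₁ := max`, `δ₀ := min`.  The family is non-vacuous at every threshold with blocks at both levels
(`B6Prop22TwoLevelCensus.twoLevel_nonvacuous`).  What is missing for the verbatim Prop (`α < 1`): an `α`-uniform rate as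
`α → 1` (§5). [cite: Balaban1984PropagatorsII, Prop. 2.2 (2.67) p.234; (2.1)–(2.2) p.224; (2.46) p.231] -/
theorem prop22Printed_twoLevel_upTo (d ℓ : ℕ) (hℓ : 1 ≤ ℓ) (β : ℝ) (hβ1 : β < 1) :
    ∃ M₁ δ₀ C : ℝ, ∃ Cα : ℝ → ℝ, 0 < M₁ ∧ 0 < δ₀ ∧ 0 < C ∧
      ∀ i : TLIdx d ℓ, i.geo.Hyp21_22 → M₁ ≤ i.geo.M →
        (∀ (n : Fin 4) (lam : i.geo.Loc) (y y' : i.geo.Site), i.geo.suppIn lam y' →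
            i.gp.e n lam y ≤ C * pref4 (i.geo.len y) n * Real.exp (-(δ₀ / 2 * i.geo.dist y y')) *
              i.geo.supNorm lam) ∧
        (∀ (α : ℝ) (lam : i.geo.Loc) (ζ : i.geo.Cut) (y y' : i.geo.Site), 0 ≤ α → α ≤ β →
            i.geo.cutIn ζ y → i.geo.suppIn lam y' →
            i.gp.h1 lam α ζ ≤ Cα α * (i.geo.len y) ^ (1 - α) * i.geo.cutH α ζ *
              Real.exp (-(δ₀ / 2 * i.geo.dist y y')) * i.geo.supNorm lam) := by
  obtain ⟨M₁, δ₁, C₁, hM₁, hδ₁, hC₁, hS⟩ := prop22_supEntries_twoLevel d ℓ hℓ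
  obtain ⟨M₂, δ₂, C₂, hM₂, hδ₂, hC₂, hH⟩ :=
    prop22_holderEntries_twoLevel_upTo d ℓ hℓ (max β 0) (le_max_right _ _) (max_lt hβ1 one_pos)
  refine ⟨max M₁ M₂, min δ₁ δ₂, C₁, fun _ => C₂, lt_max_of_lt_left hM₁, lt_min hδ₁ hδ₂, hC₁, ?_⟩
  intro i hHyp hM
  refine ⟨fun n lam y y' hsupp => ?_, fun α lam ζ y y' hα0 hαβ hcut hsupp => ?_⟩
  · have h := hS i hHyp (le_trans (le_max_left _ _) hM) n lam y y' hsupp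
    refine h.trans ?_
    have hE := exp_rate_mono i (min_le_left δ₁ δ₂) y y'
    have h0 : 0 ≤ C₁ * pref4 (i.geo.len y) n := by
      have := TLIdx.one_le_pref4 (i.one_le_len y) n
      exact mul_nonneg hC₁.le (by linarith)
    have hs0 : 0 ≤ i.geo.supNorm lam := by rw [TLIdx.geo_supNorm]; exact i.supF_nonneg lam
    exact mul_le_mul_of_nonneg_right (mul_le_mul_of_nonneg_left hE h0) hs0
  · have h := hH α hα0 (le_trans hαβ (le_max_left _ _)) i hHyp (le_trans (le_max_right _ _) hM) lam ζ y y' hcut hsupp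
    refine h.trans ?_
    have hE := exp_rate_mono i (min_le_right δ₁ δ₂) y y'
    have hcut0 : 0 ≤ i.geo.cutH α ζ := by
      change 0 ≤ i.hq α ζ + i.supF ζ
      exact add_nonneg (i.hq_nonneg α ζ) (i.supF_nonneg ζ)
    have h0 : 0 ≤ C₂ * (i.geo.len y) ^ (1 - α) * i.geo.cutH α ζ :=
      mul_nonneg (mul_nonneg hC₂.le (Real.rpow_nonneg (by linarith [i.one_le_len y]) _)) hcut0
    have hs0 : 0 ≤ i.geo.supNorm lam := by rw [TLIdx.geo_supNorm]; exact i.supF_nonneg lam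
    exact mul_le_mul_of_nonneg_right (mul_le_mul_of_nonneg_left hE h0) hs0

/-! ## §5 The reduction edge: an `α`-uniform Hölder package gives the verbatim census Prop -/

/-- **REDUCTION EDGE (a proved implication; its hypothesis is NOT discharged in the tree)**: if the Hölder entries 4, 5 on
the two-level family hold with ONE threshold `M₁` and ONE rate `δ₀` for ALL `0 ≤ α < 1` (an `α`-dependent constant allowed —
exactly the output of re-threading the [3]-chain `hkernel248_decay → … → prop22_six_twoLevelBox` in print's order «δ₀ …
depending on d, M only, c₀ on α also», [3] p. 573), then the VERBATIM `B6.Prop22Printed` holds for the genuine two-level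
operator on the family `TLIdx d ℓ` (the sup conjunct is `prop22_supEntries_twoLevel`; `M₁ := max`, `δ₀ := min`).
[cite: Balaban1984PropagatorsII, Prop. 2.2 (2.67) p.234; Balaban1983RegularityDecay, Thm (1.9) p.573] -/
theorem prop22Printed_twoLevel_of_holderUnif (d ℓ : ℕ) (hℓ : 1 ≤ ℓ)
    (hU : ∃ M₁ δ₀ : ℝ, 0 < M₁ ∧ 0 < δ₀ ∧ ∀ α : ℝ, 0 ≤ α → α < 1 → ∃ C : ℝ,
      ∀ i : TLIdx d ℓ, i.geo.Hyp21_22 → M₁ ≤ i.geo.M →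
        ∀ (lam : i.geo.Loc) (ζ : i.geo.Cut) (y y' : i.geo.Site), i.geo.cutIn ζ y → i.geo.suppIn lam y' →
          i.gp.h1 lam α ζ ≤ C * (i.geo.len y) ^ (1 - α) * i.geo.cutH α ζ *
            Real.exp (-(δ₀ / 2 * i.geo.dist y y')) * i.geo.supNorm lam) :
    Prop22Printed (fun i : TLIdx d ℓ => i.geo) (fun i => i.gp) := by
  classical
  obtain ⟨M₁, δ₁, C₁, hM₁, hδ₁, hC₁, hS⟩ := prop22_supEntries_twoLevel d ℓ hℓ
  obtain ⟨M₂, δ₂, hM₂, hδ₂, hH⟩ := hU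
  -- the exponent-dependent constant: the absolute value of the one delivered by `hU` on `[0, 1)`, `0` elsewhere
  let Cα : ℝ → ℝ := fun α => if h : 0 ≤ α ∧ α < 1 then |Classical.choose (hH α h.1 h.2)| else 0
  have hCα0 : ∀ α, 0 ≤ Cα α := by
    intro α
    by_cases h : 0 ≤ α ∧ α < 1
    · simp only [Cα, dif_pos h]; exact abs_nonneg _
    · simp only [Cα, dif_neg h]; exact le_rfl
  have hCα : ∀ α (h0 : 0 ≤ α) (h1 : α < 1), ∀ i : TLIdx d ℓ, i.geo.Hyp21_22 → M₂ ≤ i.geo.M →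
      ∀ (lam : i.geo.Loc) (ζ : i.geo.Cut) (y y' : i.geo.Site), i.geo.cutIn ζ y → i.geo.suppIn lam y' →
        i.gp.h1 lam α ζ ≤ Cα α * (i.geo.len y) ^ (1 - α) * i.geo.cutH α ζ *
          Real.exp (-(δ₂ / 2 * i.geo.dist y y')) * i.geo.supNorm lam := by
    intro α h0 h1 i hHyp hM lam ζ y y' hcut hsupp
    have e : Cα α = |Classical.choose (hH α h0 h1)| := by
      simp only [Cα, dif_pos (And.intro h0 h1)]
    rw [e]
    have h := Classical.choose_spec (hH α h0 h1) i hHyp hM lam ζ y y' hcut hsupp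
    refine h.trans ?_
    have hcut0 : 0 ≤ i.geo.cutH α ζ := by
      change 0 ≤ i.hq α ζ + i.supF ζ
      exact add_nonneg (i.hq_nonneg α ζ) (i.supF_nonneg ζ)
    have hs0 : 0 ≤ i.geo.supNorm lam := by rw [TLIdx.geo_supNorm]; exact i.supF_nonneg lam
    have hl0 : 0 ≤ (i.geo.len y) ^ (1 - α) := Real.rpow_nonneg (by linarith [i.one_le_len y]) _
    have hP : 0 ≤ (i.geo.len y) ^ (1 - α) * i.geo.cutH α ζ * Real.exp (-(δ₂ / 2 * i.geo.dist y y')) *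
        i.geo.supNorm lam := by positivity
    have := mul_le_mul_of_nonneg_right (le_abs_self (Classical.choose (hH α h0 h1))) hP
    calc Classical.choose (hH α h0 h1) * (i.geo.len y) ^ (1 - α) * i.geo.cutH α ζ *
          Real.exp (-(δ₂ / 2 * i.geo.dist y y')) * i.geo.supNorm lam
        = Classical.choose (hH α h0 h1) * ((i.geo.len y) ^ (1 - α) * i.geo.cutH α ζ *
          Real.exp (-(δ₂ / 2 * i.geo.dist y y')) * i.geo.supNorm lam) := by ring
      _ ≤ |Classical.choose (hH α h0 h1)| * ((i.geo.len y) ^ (1 - α) * i.geo.cutH α ζ *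
          Real.exp (-(δ₂ / 2 * i.geo.dist y y')) * i.geo.supNorm lam) := this
      _ = _ := by ring
  refine ⟨max M₁ M₂, min δ₁ δ₂, C₁, Cα, lt_max_of_lt_left hM₁, lt_min hδ₁ hδ₂, hC₁, ?_⟩
  intro i hHyp hM
  refine ⟨fun n lam y y' hsupp => ?_, fun α lam ζ y y' hα0 hα1 hcut hsupp => ?_⟩
  · have h := hS i hHyp (le_trans (le_max_left _ _) hM) n lam y y' hsupp
    refine h.trans ?_
    have hE := exp_rate_mono i (min_le_left δ₁ δ₂) y y'
    have h0 : 0 ≤ C₁ * pref4 (i.geo.len y) n := by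
      have := TLIdx.one_le_pref4 (i.one_le_len y) n
      exact mul_nonneg hC₁.le (by linarith)
    have hs0 : 0 ≤ i.geo.supNorm lam := by rw [TLIdx.geo_supNorm]; exact i.supF_nonneg lam
    exact mul_le_mul_of_nonneg_right (mul_le_mul_of_nonneg_left hE h0) hs0
  · have h := hCα α hα0 hα1 i hHyp (le_trans (le_max_right _ _) hM) lam ζ y y' hcut hsupp
    refine h.trans ?_
    have hE := exp_rate_mono i (min_le_right δ₁ δ₂) y y'
    have hcut0 : 0 ≤ i.geo.cutH α ζ := by
      change 0 ≤ i.hq α ζ + i.supF ζ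
      exact add_nonneg (i.hq_nonneg α ζ) (i.supF_nonneg ζ)
    have hs0 : 0 ≤ i.geo.supNorm lam := by rw [TLIdx.geo_supNorm]; exact i.supF_nonneg lam
    have hl0 : 0 ≤ (i.geo.len y) ^ (1 - α) := Real.rpow_nonneg (by linarith [i.one_le_len y]) _
    have h0 : 0 ≤ Cα α * (i.geo.len y) ^ (1 - α) * i.geo.cutH α ζ := mul_nonneg (mul_nonneg (hCα0 α) hl0) hcut0
    exact mul_le_mul_of_nonneg_right (mul_le_mul_of_nonneg_left hE h0) hs0

end Literature.MathematicalPhysics.QuantumFieldTheory.Balaban1983to89.B6Prop22TwoLevelCensusUpTo
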